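import Literature.IUT.LogVolume.Corollary22Thm110LegendreWitness
import Literature.IUT.LogVolume.FakeAdeleIndexLocalDegree
import Mathlib.FieldTheory.KummerPolynomial
import HarnessLib

/-!
# An explicit QUADRATIC family on the `λ`-line: `λ_k = 1/2 + 2/(3 + √2)^k ∈ ℚ(√2)` — the field, the two places over `7`,
# and the orders of `λ_k` and `j(λ_k)` there (arithmetic input for the degree-2 admissibility witness)

Proof/definition file of the abc-iut cell (R2 S-chain seat abc-iut-s2-p5); CLASSICAL arithmetic of the `λ`-line, nothing disputed
is used or asserted. Degree-2 companion of abc-iut-S-d3's `Corollary22Thm110LegendreWitness` (rational family `1/2 + 2/7^k`): every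
`d_mod ≥ 2` statement of the branch-C scoreboard (`hvol` off the «d = 1 cut», its trades `hres`/`hSz`, the necessity certificates)
quantifies over ADMISSIBLE `λ` with `[ℚ(j(λ)):ℚ] ≥ 2`; this file supplies an explicit such family over `F = ℚ(√2) = AdjoinRoot(X² − 2)`
at the SPLIT prime `7 = (3 + √2)(3 − √2)`: the conjugation `σ`, the integers `a = 3 + √2`, `ā = 3 − √2`, two places `𝔭 ∋ a`, `𝔭' ∋ ā`
over `7` with `a ∉ 𝔭'`, `ā ∉ 𝔭` (`exists_places`, from ONE place over `7` and `σ`), `lam k = 1/2 + 2/a^k` with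
`j(λ_k) = 64(3a^{2k}+16)³/(a^{2k}(a^k+4)²(4−a^k)²)` (`jInv_lam_eq`), and the orders `ord_at_bad` (at `𝔭`: `ord λ_k = −k·ord a`,
`ord j(λ_k) = −2k·ord a ≤ −2k`) / `ord_at_good` (at `𝔭'`: both `0`; `a ≡ −1 mod 𝔭'`) — the prime `7` is MIXED for `λ_k`, which forces
`j(λ_k) ∉ ℚ`. Admissibility (`K_V`, `AdmitsCore`, `UP`, `2 ≤ d_mod`, (P2)/(P5)/(P6), unbounded `log(q^∀)`) is drawn in the companion
`Conditional/AbcOfSHvolAdmissibleDegTwo.lean`. [cite: MochizukiGenEll2010, Ex 1.3 (ii) p.5]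
[cite: Mochizuki2012, IUTchIV Cor 2.2 (ii) proof (P2)(P5) p.45-46] for the notions instantiated. No side taken on [IUTchIII] Cor. 3.12.
-/

noncomputable section

namespace Summit.ABC.IUTFork.QuadWitness

open NumberField IsDedekindDomain Polynomial Literature.NumberTheory.DiophantineGeometry.GenEll
open Literature.IUT.LogVolume Literature.IUT.LogVolume.Cor22

/-- `X² − 2` is irreducible over `ℚ` (`√2 ∉ ℚ`). [folklore] -/
theorem irreducible_X_sq_sub_two : Irreducible (X ^ 2 - C (2 : ℚ) : ℚ[X]) := by
  refine X_pow_sub_C_irreducible_of_prime Nat.prime_two fun b hb => ?_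
  have h2 : Real.sqrt 2 = |(b : ℝ)| := by
    rw [← Real.sqrt_sq_eq_abs]
    congr 1
    exact_mod_cast hb.symm
  exact irrational_sqrt_two ⟨|b|, by rw [h2]; push_cast; rfl⟩

/-- The polynomial `X² − 2` (kept as a named constant so that rewriting does not see through the carrier). -/
def fpoly : ℚ[X] := X ^ 2 - C 2

/-- `fpoly_eq` (arithmetic of the family `λ_k = 1/2 + 2/(3+√2)^k` over `ℚ(√2)`). [cite: MochizukiGenEll2010, Ex 1.3 (ii) p.5] -/
theorem fpoly_eq : fpoly = X ^ 2 - C 2 := rfl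

/-- The quadratic field `F = ℚ(√2) = ℚ[X]/(X² − 2)`. [folklore] -/
abbrev F : Type := AdjoinRoot fpoly

/-- `:` (arithmetic of the family `λ_k = 1/2 + 2/(3+√2)^k` over `ℚ(√2)`). [cite: MochizukiGenEll2010, Ex 1.3 (ii) p.5] -/
instance fact_irreducible_fpoly : Fact (Irreducible fpoly) := ⟨irreducible_X_sq_sub_two⟩

/-- `fpoly_ne_zero` (arithmetic of the family `λ_k = 1/2 + 2/(3+√2)^k` over `ℚ(√2)`). [cite: MochizukiGenEll2010, Ex 1.3 (ii) p.5] -/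
theorem fpoly_ne_zero : fpoly ≠ 0 := (irreducible_X_sq_sub_two).ne_zero

/-- `:` (arithmetic of the family `λ_k = 1/2 + 2/(3+√2)^k` over `ℚ(√2)`). [cite: MochizukiGenEll2010, Ex 1.3 (ii) p.5] -/
instance charZero_F : CharZero F := charZero_of_injective_algebraMap (algebraMap ℚ F).injective

/-- `:` (arithmetic of the family `λ_k = 1/2 + 2/(3+√2)^k` over `ℚ(√2)`). [cite: MochizukiGenEll2010, Ex 1.3 (ii) p.5] -/
instance finiteDimensional_F : FiniteDimensional ℚ F := (AdjoinRoot.powerBasis fpoly_ne_zero).finite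

/-- `:` (arithmetic of the family `λ_k = 1/2 + 2/(3+√2)^k` over `ℚ(√2)`). [cite: MochizukiGenEll2010, Ex 1.3 (ii) p.5] -/
instance numberField_F : NumberField F := NumberField.mk

/-- `fpoly` evaluates as `x² − 2`. -/
theorem eval₂_fpoly {S : Type*} [CommRing S] (i : ℚ →+* S) (x : S) : eval₂ i x fpoly = x ^ 2 - 2 := by
  show eval₂ i x (X ^ 2 - C 2) = _
  simp [eval₂_sub, eval₂_X_pow, eval₂_C, map_ofNat i 2]

/-- `s = √2 ∈ F`. -/
def s : F := AdjoinRoot.root fpoly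

/-- `s_sq` (arithmetic of the family `λ_k = 1/2 + 2/(3+√2)^k` over `ℚ(√2)`). [cite: MochizukiGenEll2010, Ex 1.3 (ii) p.5] -/
theorem s_sq : s ^ 2 = 2 := by
  have h := AdjoinRoot.eval₂_root fpoly
  rw [eval₂_fpoly] at h
  exact sub_eq_zero.mp h

/-- The conjugation `σ : √2 ↦ −√2`. -/
def σ : F →ₐ[ℚ] F :=
  AdjoinRoot.liftAlgHom fpoly (Algebra.ofId ℚ F) (-s) (by rw [eval₂_fpoly, neg_sq, s_sq, sub_self])

/-- `σ_s` (arithmetic of the family `λ_k = 1/2 + 2/(3+√2)^k` over `ℚ(√2)`). [cite: MochizukiGenEll2010, Ex 1.3 (ii) p.5] -/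
theorem σ_s : σ s = -s :=
  AdjoinRoot.liftAlgHom_root _ _ _ _

/-- `σ_σ` (arithmetic of the family `λ_k = 1/2 + 2/(3+√2)^k` over `ℚ(√2)`). [cite: MochizukiGenEll2010, Ex 1.3 (ii) p.5] -/
theorem σ_σ (x : F) : σ (σ x) = x := by
  have h : σ.comp σ = AlgHom.id ℚ F := by
    refine AdjoinRoot.algHom_ext ?_
    change σ (σ s) = s
    rw [σ_s, map_neg, σ_s, neg_neg]
  exact congrArg (fun φ : F →ₐ[ℚ] F => φ x) h

/-! ## Integers `a = 3 + √2`, `ā = 3 − √2` (`a·ā = 7`, `a + ā = 6`), conjugation on `𝓞_F`, the two places over `7` -/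

/-- `isIntegral_s` (arithmetic of the family `λ_k = 1/2 + 2/(3+√2)^k` over `ℚ(√2)`). [cite: MochizukiGenEll2010, Ex 1.3 (ii) p.5] -/
theorem isIntegral_s : IsIntegral ℤ s :=
  ⟨X ^ 2 - C 2, monic_X_pow_sub_C (2 : ℤ) two_ne_zero, by simp [eval₂_sub, eval₂_X_pow, s_sq]⟩

/-- `√2` as an algebraic integer. -/
def sI : 𝓞 F := ⟨s, isIntegral_s⟩

/-- `a = 3 + √2 ∈ 𝓞_F` (a prime element of norm `7`). -/
def a : 𝓞 F := 3 + sI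

/-- `ā = 3 − √2 ∈ 𝓞_F`. -/
def abar : 𝓞 F := 3 - sI

/-- `a_mul_abar` (arithmetic of the family `λ_k = 1/2 + 2/(3+√2)^k` over `ℚ(√2)`). [cite: MochizukiGenEll2010, Ex 1.3 (ii) p.5] -/
theorem a_mul_abar : a * abar = 7 := by
  apply RingOfIntegers.coe_injective
  change (3 + s) * (3 - s) = (7 : F)
  have h : (3 + s) * (3 - s) = 9 - s ^ 2 := by ring
  rw [h, s_sq]
  norm_num

/-- `a_add_abar` (arithmetic of the family `λ_k = 1/2 + 2/(3+√2)^k` over `ℚ(√2)`). [cite: MochizukiGenEll2010, Ex 1.3 (ii) p.5] -/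
theorem a_add_abar : a + abar = 6 := by
  apply RingOfIntegers.coe_injective; change (3 + s) + (3 - s) = (6 : F); ring

/-- `three_add_s_ne_zero` (arithmetic of the family `λ_k = 1/2 + 2/(3+√2)^k` over `ℚ(√2)`). [cite: MochizukiGenEll2010, Ex 1.3 (ii) p.5] -/
theorem three_add_s_ne_zero : (3 : F) + s ≠ 0 := by
  intro h
  have h7 : ((a * abar : 𝓞 F) : F) = 0 := by
    change (3 + s) * (3 - s) = (0 : F)
    rw [h, zero_mul]
  rw [a_mul_abar] at h7
  norm_num at h7

/-- The conjugation on `𝓞_F`. -/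
def σI : 𝓞 F →+* 𝓞 F := RingOfIntegers.mapRingHom (σ : F →+* F)

/-- `σI_σI` (arithmetic of the family `λ_k = 1/2 + 2/(3+√2)^k` over `ℚ(√2)`). [cite: MochizukiGenEll2010, Ex 1.3 (ii) p.5] -/
theorem σI_σI (x : 𝓞 F) : σI (σI x) = x := by
  apply RingOfIntegers.coe_injective; change σ (σ (x : F)) = (x : F); exact σ_σ _

/-- `σI_a` (arithmetic of the family `λ_k = 1/2 + 2/(3+√2)^k` over `ℚ(√2)`). [cite: MochizukiGenEll2010, Ex 1.3 (ii) p.5] -/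
theorem σI_a : σI a = abar := by
  apply RingOfIntegers.coe_injective
  change σ (3 + s) = 3 - s
  rw [map_add, σ_s, map_ofNat σ 3, sub_eq_add_neg]

/-- `σI_abar` (arithmetic of the family `λ_k = 1/2 + 2/(3+√2)^k` over `ℚ(√2)`). [cite: MochizukiGenEll2010, Ex 1.3 (ii) p.5] -/
theorem σI_abar : σI abar = a := by
  rw [← σI_a, σI_σI]

/-- The conjugate place `σ(v)`. -/
def conjPlace (v : HeightOneSpectrum (𝓞 F)) : HeightOneSpectrum (𝓞 F) :=
  ⟨v.asIdeal.comap σI, Ideal.IsPrime.comap σI, fun h => by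
    obtain ⟨x, hx, hx0⟩ := v.asIdeal.ne_bot_iff.mp v.ne_bot   -- hmm: Submodule.ne_bot_iff
    have hmem : σI x ∈ v.asIdeal.comap σI := by
      rw [Ideal.mem_comap, σI_σI]
      exact hx
    rw [h, Ideal.mem_bot] at hmem
    apply hx0
    rw [← σI_σI x, hmem, map_zero]⟩

/-- `mem_conjPlace` (arithmetic of the family `λ_k = 1/2 + 2/(3+√2)^k` over `ℚ(√2)`). [cite: MochizukiGenEll2010, Ex 1.3 (ii) p.5] -/
theorem mem_conjPlace {v : HeightOneSpectrum (𝓞 F)} {x : 𝓞 F} : x ∈ (conjPlace v).asIdeal ↔ σI x ∈ v.asIdeal :=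
  Ideal.mem_comap

/-- A natural number prime to `7` is not in a place containing `7`. -/
theorem natCast_not_mem_of_coprime {v : HeightOneSpectrum (𝓞 F)} (h7 : ((7 : ℕ) : 𝓞 F) ∈ v.asIdeal) {n : ℕ}
    (hn : Nat.Coprime n 7) : ((n : ℕ) : 𝓞 F) ∉ v.asIdeal := by
  intro hmem
  obtain ⟨u, w, huw⟩ := (Nat.isCoprime_iff_coprime.mpr hn : IsCoprime (n : ℤ) (7 : ℤ))
  have h1 : (1 : 𝓞 F) ∈ v.asIdeal := by
    have e : (1 : 𝓞 F) = (u : 𝓞 F) * ((n : ℕ) : 𝓞 F) + (w : 𝓞 F) * ((7 : ℕ) : 𝓞 F) := by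
      have := congrArg (fun z : ℤ => (z : 𝓞 F)) huw
      push_cast at this ⊢
      exact this.symm
    rw [e]
    exact v.asIdeal.add_mem (v.asIdeal.mul_mem_left _ hmem) (v.asIdeal.mul_mem_left _ h7)
  exact v.isPrime.ne_top ((Ideal.eq_top_iff_one _).mpr h1)

/-- From a place `v` containing `7` and `a`: the pair `(v, σ v)` separates `a` and `ā`. -/
theorem places_of_mem {v : HeightOneSpectrum (𝓞 F)} (h7 : ((7 : ℕ) : 𝓞 F) ∈ v.asIdeal) (ha : a ∈ v.asIdeal) :
    a ∈ v.asIdeal ∧ abar ∈ (conjPlace v).asIdeal ∧ a ∉ (conjPlace v).asIdeal ∧ abar ∉ v.asIdeal ∧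
      ((7 : ℕ) : 𝓞 F) ∈ v.asIdeal ∧ ((7 : ℕ) : 𝓞 F) ∈ (conjPlace v).asIdeal := by
  have h6 : ((6 : ℕ) : 𝓞 F) ∉ v.asIdeal := natCast_not_mem_of_coprime h7 (by norm_num)
  have hsum : a + abar = ((6 : ℕ) : 𝓞 F) := by rw [a_add_abar]; norm_num
  have habar : abar ∉ v.asIdeal := fun h => h6 (hsum ▸ v.asIdeal.add_mem ha h)
  refine ⟨ha, mem_conjPlace.mpr (by rw [σI_abar]; exact ha), fun h => habar ?_, habar, h7,
    mem_conjPlace.mpr (by rw [map_natCast]; exact h7)⟩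
  rw [mem_conjPlace, σI_a] at h
  exact h

/-- **The two places of `F = ℚ(√2)` over `7`**: `𝔭 ∋ a = 3 + √2`, `𝔭' ∋ ā = 3 − √2`, `a ∉ 𝔭'`, `ā ∉ 𝔭`. -/
theorem exists_places : ∃ 𝔭 𝔭' : HeightOneSpectrum (𝓞 F),
    a ∈ 𝔭.asIdeal ∧ abar ∈ 𝔭'.asIdeal ∧ a ∉ 𝔭'.asIdeal ∧ abar ∉ 𝔭.asIdeal ∧
      ((7 : ℕ) : 𝓞 F) ∈ 𝔭.asIdeal ∧ ((7 : ℕ) : 𝓞 F) ∈ 𝔭'.asIdeal := by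
  haveI : Fact (Nat.Prime 7) := ⟨by norm_num⟩
  obtain ⟨v, hv⟩ := placesOver_nonempty F 7
  have h7 : ((7 : ℕ) : 𝓞 F) ∈ v.asIdeal := by
    have h := natCast_residueChar_mem F v
    rwa [(mem_placesOver_iff_residueChar v).mp hv] at h
  have hprod : a * abar ∈ v.asIdeal := by rw [a_mul_abar]; exact_mod_cast h7
  rcases v.isPrime.mem_or_mem hprod with ha | habar
  · exact ⟨v, conjPlace v, places_of_mem h7 ha⟩
  · have ha' : a ∈ (conjPlace v).asIdeal := mem_conjPlace.mpr (by rw [σI_a]; exact habar)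
    have h7' : ((7 : ℕ) : 𝓞 F) ∈ (conjPlace v).asIdeal := mem_conjPlace.mpr (by rw [map_natCast]; exact h7)
    obtain ⟨h1, h2, h3, h4, h5, h6⟩ := places_of_mem h7' ha'
    exact ⟨conjPlace v, conjPlace (conjPlace v), h1, h2, h3, h4, h5, h6⟩

/-! ## Valuations at the two places over `7` -/

section Ord

variable {v : HeightOneSpectrum (𝓞 F)}

/-- An algebraic integer outside `v` has `ord_v = 0`. -/
theorem ord_coe_eq_zero_of_not_mem {x : 𝓞 F} (hx : x ∉ v.asIdeal) : ord F v (x : F) = 0 := by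
  have h0 : x ≠ 0 := fun h => hx (h ▸ v.asIdeal.zero_mem)
  have h1 := ord_nonneg_of_isIntegral F v x
  have h2 : ¬ 0 < ord F v (x : F) := fun h => hx ((ord_pos_iff_mem F v x h0).mp h)
  omega

/-- `a_ne_zero` (arithmetic of the family `λ_k = 1/2 + 2/(3+√2)^k` over `ℚ(√2)`). [cite: MochizukiGenEll2010, Ex 1.3 (ii) p.5] -/
theorem a_ne_zero : (a : 𝓞 F) ≠ 0 := fun h => by
  have := a_mul_abar
  rw [h, zero_mul] at this
  exact absurd this (by norm_num)

/-- `ord_𝔭(a) ≥ 1` at a place containing `a`. -/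
theorem one_le_ord_a (ha : a ∈ v.asIdeal) : 1 ≤ ord F v (a : F) :=
  (ord_pos_iff_mem F v a a_ne_zero).mpr ha

variable (h7 : ((7 : ℕ) : 𝓞 F) ∈ v.asIdeal)
include h7

/-- `2 ∉ v`, `ord_v 2 = 0` (and likewise for `4`, `16`, `64`). -/
theorem ord_natCast_eq_zero {n : ℕ} (hn : Nat.Coprime n 7) : ord F v (n : F) = 0 := by
  have h := ord_coe_eq_zero_of_not_mem (natCast_not_mem_of_coprime h7 hn)
  exact_mod_cast h

/-- At the place `𝔭 ∋ a`: `a^k + 4`, `4 − a^k`, `3·a^{2k} + 16` are `𝔭`-units (`≡ 4, 4, 16`). -/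
theorem not_mem_of_mem_a (ha : a ∈ v.asIdeal) {k : ℕ} (hk : 1 ≤ k) :
    (a ^ k + 4 : 𝓞 F) ∉ v.asIdeal ∧ (4 - a ^ k : 𝓞 F) ∉ v.asIdeal ∧ (3 * a ^ (2 * k) + 16 : 𝓞 F) ∉ v.asIdeal := by
  have hak : ∀ m : ℕ, 1 ≤ m → (a ^ m : 𝓞 F) ∈ v.asIdeal := fun m hm => by
    obtain ⟨m', rfl⟩ := Nat.exists_eq_add_of_le' hm
    rw [pow_succ]
    exact v.asIdeal.mul_mem_left _ ha
  have h4 : ((4 : ℕ) : 𝓞 F) ∉ v.asIdeal := natCast_not_mem_of_coprime h7 (by norm_num)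
  have h16 : ((16 : ℕ) : 𝓞 F) ∉ v.asIdeal := natCast_not_mem_of_coprime h7 (by norm_num)
  refine ⟨fun h => h4 ?_, fun h => h4 ?_, fun h => h16 ?_⟩
  · have := v.asIdeal.sub_mem h (hak k hk); push_cast; simpa using this
  · have := v.asIdeal.add_mem h (hak k hk); push_cast; simpa using this
  · have := v.asIdeal.sub_mem h (v.asIdeal.mul_mem_left 3 (hak (2 * k) (by omega))); push_cast; simpa using this

/-- At the place `𝔭' ∋ ā` (`a ≡ −1`): `a^k + 4`, `4 − a^k`, `3·a^{2k} + 16` are `𝔭'`-units (`≡ ±1 + 4, 4 ∓ 1, 19`). -/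
theorem not_mem_of_mem_abar (habar : abar ∈ v.asIdeal) (k : ℕ) :
    (a ^ k + 4 : 𝓞 F) ∉ v.asIdeal ∧ (4 - a ^ k : 𝓞 F) ∉ v.asIdeal ∧ (3 * a ^ (2 * k) + 16 : 𝓞 F) ∉ v.asIdeal := by
  -- `a + 1 = 7 − ā ∈ v`, so `a^m − (−1)^m ∈ v`
  have ha1 : (a + 1 : 𝓞 F) ∈ v.asIdeal := by
    have e : (a + 1 : 𝓞 F) = ((7 : ℕ) : 𝓞 F) - abar := by
      have := a_add_abar; push_cast at this ⊢; linear_combination this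
    rw [e]; exact v.asIdeal.sub_mem h7 habar
  have hpow : ∀ m : ℕ, (a ^ m - (-1) ^ m : 𝓞 F) ∈ v.asIdeal := fun m => by
    obtain ⟨c, hc⟩ := sub_dvd_pow_sub_pow (a : 𝓞 F) (-1) m
    rw [hc, sub_neg_eq_add]
    exact v.asIdeal.mul_mem_right _ ha1
  have h3 : ((3 : ℕ) : 𝓞 F) ∉ v.asIdeal := natCast_not_mem_of_coprime h7 (by norm_num)
  have h5 : ((5 : ℕ) : 𝓞 F) ∉ v.asIdeal := natCast_not_mem_of_coprime h7 (by norm_num)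
  have h19 : ((19 : ℕ) : 𝓞 F) ∉ v.asIdeal := natCast_not_mem_of_coprime h7 (by norm_num)
  refine ⟨fun h => ?_, fun h => ?_, fun h => h19 ?_⟩
  · -- `a^k + 4 − (a^k − (−1)^k) = (−1)^k + 4 ∈ {3, 5}`
    have hm := v.asIdeal.sub_mem h (hpow k)
    rcases Nat.even_or_odd k with he | ho
    · rw [he.neg_one_pow] at hm; exact h5 (by push_cast; convert hm using 1; ring)
    · rw [ho.neg_one_pow] at hm; exact h3 (by push_cast; convert hm using 1; ring)
  · have hm := v.asIdeal.add_mem h (hpow k)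
    rcases Nat.even_or_odd k with he | ho
    · rw [he.neg_one_pow] at hm; exact h3 (by push_cast; convert hm using 1; ring)
    · rw [ho.neg_one_pow] at hm; exact h5 (by push_cast; convert hm using 1; ring)
  · have hm := v.asIdeal.sub_mem h (v.asIdeal.mul_mem_left 3 (hpow (2 * k)))
    rw [(even_two_mul k).neg_one_pow] at hm
    push_cast; convert hm using 1; ring

end Ord

/-! ## The points `λ_k = 1/2 + 2/(3 + √2)^k` and the orders of `j(λ_k)` at the two places over `7` -/

/-- `λ_k = 1/2 + 2/(3 + √2)^k ∈ F`. -/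
def lam (k : ℕ) : F := 2⁻¹ + 2 / (a : F) ^ k

/-- `coe_a_ne_zero` (arithmetic of the family `λ_k = 1/2 + 2/(3+√2)^k` over `ℚ(√2)`). [cite: MochizukiGenEll2010, Ex 1.3 (ii) p.5] -/
theorem coe_a_ne_zero : (a : F) ≠ 0 := three_add_s_ne_zero

/-- `coe_N` (arithmetic of the family `λ_k = 1/2 + 2/(3+√2)^k` over `ℚ(√2)`). [cite: MochizukiGenEll2010, Ex 1.3 (ii) p.5] -/
theorem coe_N (k : ℕ) : ((a ^ k + 4 : 𝓞 F) : F) = (a : F) ^ k + 4 := by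
  simp [map_add, map_pow, map_ofNat (algebraMap (𝓞 F) F) 4]

/-- `coe_N1` (arithmetic of the family `λ_k = 1/2 + 2/(3+√2)^k` over `ℚ(√2)`). [cite: MochizukiGenEll2010, Ex 1.3 (ii) p.5] -/
theorem coe_N1 (k : ℕ) : ((4 - a ^ k : 𝓞 F) : F) = 4 - (a : F) ^ k := by
  simp [map_sub, map_pow, map_ofNat (algebraMap (𝓞 F) F) 4]

/-- `coe_N2` (arithmetic of the family `λ_k = 1/2 + 2/(3+√2)^k` over `ℚ(√2)`). [cite: MochizukiGenEll2010, Ex 1.3 (ii) p.5] -/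
theorem coe_N2 (k : ℕ) : ((3 * a ^ (2 * k) + 16 : 𝓞 F) : F) = 3 * (a : F) ^ (2 * k) + 16 := by
  simp [map_add, map_mul, map_pow, map_ofNat (algebraMap (𝓞 F) F) 3, map_ofNat (algebraMap (𝓞 F) F) 16]

/-- `lam_eq` (arithmetic of the family `λ_k = 1/2 + 2/(3+√2)^k` over `ℚ(√2)`). [cite: MochizukiGenEll2010, Ex 1.3 (ii) p.5] -/
theorem lam_eq (k : ℕ) : lam k = ((a : F) ^ k + 4) / (2 * (a : F) ^ k) := by
  have h := pow_ne_zero k coe_a_ne_zero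
  rw [lam]
  field_simp
  ring

/-- `lam_sub_one_eq` (arithmetic of the family `λ_k = 1/2 + 2/(3+√2)^k` over `ℚ(√2)`). [cite: MochizukiGenEll2010, Ex 1.3 (ii) p.5] -/
theorem lam_sub_one_eq (k : ℕ) : lam k - 1 = (4 - (a : F) ^ k) / (2 * (a : F) ^ k) := by
  have h := pow_ne_zero k coe_a_ne_zero
  rw [lam]
  field_simp
  ring

/-- `lam_sq_sub_eq` (arithmetic of the family `λ_k = 1/2 + 2/(3+√2)^k` over `ℚ(√2)`). [cite: MochizukiGenEll2010, Ex 1.3 (ii) p.5] -/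
theorem lam_sq_sub_eq (k : ℕ) : lam k ^ 2 - lam k + 1 = (3 * (a : F) ^ (2 * k) + 16) / (4 * (a : F) ^ (2 * k)) := by
  have h := pow_ne_zero k coe_a_ne_zero
  rw [lam, pow_mul']
  field_simp
  ring

/-- `j(λ_k) = 64·(3a^{2k} + 16)³ / (a^{2k}·(a^k + 4)²·(4 − a^k)²)`. -/
theorem jInv_lam_eq (k : ℕ) (hN : (a : F) ^ k + 4 ≠ 0) (hN1 : 4 - (a : F) ^ k ≠ 0) :
    jInv (lam k) = 64 * (3 * (a : F) ^ (2 * k) + 16) ^ 3 /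
      ((a : F) ^ (2 * k) * ((a : F) ^ k + 4) ^ 2 * (4 - (a : F) ^ k) ^ 2) := by
  have h := pow_ne_zero k coe_a_ne_zero
  rw [jInv, lam_sq_sub_eq, show lam k ^ 2 * (lam k - 1) ^ 2 = (lam k * (lam k - 1)) ^ 2 by ring,
    lam_sub_one_eq, lam_eq, pow_mul']
  field_simp
  ring

/-- `ord_v(x/y) = ord_v x − ord_v y`. -/
theorem ord_div' (v : HeightOneSpectrum (𝓞 F)) {x y : F} (hx : x ≠ 0) (hy : y ≠ 0) :
    ord F v (x / y) = ord F v x - ord F v y := by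
  rw [div_eq_mul_inv, ord_mul F v hx (inv_ne_zero hy), ord_inv, sub_eq_add_neg]

/-- `coe_ne_zero_of_not_mem` (arithmetic of the family `λ_k = 1/2 + 2/(3+√2)^k` over `ℚ(√2)`). [cite: MochizukiGenEll2010, Ex 1.3 (ii) p.5] -/
theorem coe_ne_zero_of_not_mem {v : HeightOneSpectrum (𝓞 F)} {x : 𝓞 F} (hx : x ∉ v.asIdeal) : (x : F) ≠ 0 := by
  intro h
  apply hx
  rw [(RingOfIntegers.coe_eq_zero_iff).mp h]
  exact v.asIdeal.zero_mem

section OrdJ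

variable {v : HeightOneSpectrum (𝓞 F)} (h7 : ((7 : ℕ) : 𝓞 F) ∈ v.asIdeal)
include h7

/-- The orders of `λ_k` and `j(λ_k)` at a place over `7`, in terms of `ord_v(a)`, GIVEN that the three numerators
`a^k + 4`, `4 − a^k`, `3a^{2k} + 16` are `v`-units. -/
theorem ord_lam_jInv_of_units {k : ℕ} (hN : (a ^ k + 4 : 𝓞 F) ∉ v.asIdeal) (hN1 : (4 - a ^ k : 𝓞 F) ∉ v.asIdeal)
    (hN2 : (3 * a ^ (2 * k) + 16 : 𝓞 F) ∉ v.asIdeal) :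
    ord F v (lam k) = -(k * ord F v (a : F)) ∧ ord F v (jInv (lam k)) = -(2 * k * ord F v (a : F)) := by
  have cN := coe_ne_zero_of_not_mem hN
  have cN1 := coe_ne_zero_of_not_mem hN1
  have cN2 := coe_ne_zero_of_not_mem hN2
  rw [coe_N] at cN
  rw [coe_N1] at cN1
  rw [coe_N2] at cN2
  have oN : ord F v ((a : F) ^ k + 4) = 0 := by rw [← coe_N]; exact ord_coe_eq_zero_of_not_mem hN
  have oN1 : ord F v (4 - (a : F) ^ k) = 0 := by rw [← coe_N1]; exact ord_coe_eq_zero_of_not_mem hN1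
  have oN2 : ord F v (3 * (a : F) ^ (2 * k) + 16) = 0 := by rw [← coe_N2]; exact ord_coe_eq_zero_of_not_mem hN2
  have o2 : ord F v (2 : F) = 0 := by exact_mod_cast ord_natCast_eq_zero h7 (n := 2) (by norm_num)
  have o64 : ord F v (64 : F) = 0 := by exact_mod_cast ord_natCast_eq_zero h7 (n := 64) (by norm_num)
  have hA : (a : F) ^ k ≠ 0 := pow_ne_zero k coe_a_ne_zero
  have hA2 : (a : F) ^ (2 * k) ≠ 0 := pow_ne_zero _ coe_a_ne_zero
  have h2 : (2 : F) ≠ 0 := two_ne_zero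
  have h64 : (64 : F) ≠ 0 := by norm_num
  constructor
  · rw [lam_eq, ord_div' v cN (mul_ne_zero h2 hA), ord_mul F v h2 hA, oN, o2, ord_pow]
    ring
  · rw [jInv_lam_eq k cN cN1, ord_div' v (mul_ne_zero h64 (pow_ne_zero 3 cN2))
      (mul_ne_zero (mul_ne_zero hA2 (pow_ne_zero 2 cN)) (pow_ne_zero 2 cN1)),
      ord_mul F v h64 (pow_ne_zero 3 cN2), ord_mul F v (mul_ne_zero hA2 (pow_ne_zero 2 cN)) (pow_ne_zero 2 cN1),
      ord_mul F v hA2 (pow_ne_zero 2 cN), ord_pow, ord_pow, ord_pow, ord_pow, oN, oN1, oN2, o64]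
    push_cast
    ring

/-- **At the bad place `𝔭 ∋ a` (`k ≥ 1`): `ord_𝔭 λ_k = −k·ord_𝔭(a) < 0` and `ord_𝔭 j(λ_k) = −2k·ord_𝔭(a) ≤ −2k`.** -/
theorem ord_at_bad (ha : a ∈ v.asIdeal) {k : ℕ} (hk : 1 ≤ k) :
    ord F v (lam k) = -(k * ord F v (a : F)) ∧ ord F v (jInv (lam k)) = -(2 * k * ord F v (a : F)) ∧
      1 ≤ ord F v (a : F) := by
  obtain ⟨hN, hN1, hN2⟩ := not_mem_of_mem_a h7 ha hk
  obtain ⟨h1, h2⟩ := ord_lam_jInv_of_units h7 hN hN1 hN2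
  exact ⟨h1, h2, one_le_ord_a ha⟩

/-- **At the good place `𝔭' ∋ ā`, `a ∉ 𝔭'`: `ord_{𝔭'} λ_k = 0` and `ord_{𝔭'} j(λ_k) = 0`.** -/
theorem ord_at_good (habar : abar ∈ v.asIdeal) (ha : a ∉ v.asIdeal) (k : ℕ) :
    ord F v (lam k) = 0 ∧ ord F v (jInv (lam k)) = 0 := by
  obtain ⟨hN, hN1, hN2⟩ := not_mem_of_mem_abar h7 habar k
  obtain ⟨h1, h2⟩ := ord_lam_jInv_of_units h7 hN hN1 hN2
  rw [ord_coe_eq_zero_of_not_mem ha] at h1 h2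
  simp only [mul_zero, neg_zero] at h1 h2
  exact ⟨h1, h2⟩

end OrdJ

end Summit.ABC.IUTFork.QuadWitness

end
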